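import Summits.Ventures.PercRepro.ProfileBiIndepNormConsColoop

/-!
# PercRepro — THE BOOLEAN STEPS OF (NC), AND (NC) FOR EVERY UNIFORM MATROID (p10, gen 29; proofs/P10-NC-g29.md §2(e), §8)

The step of (NC) at level `j` only involves the levels `j` and `j + 1`: if every `(j + 1)`-subset and every `(n − j)`-subset
of `E` is independent, then `BI_j` and `BI_{j+1}` are the whole Boolean levels and every `j`-set is its own closure, so the step
is the local LYM inequality `u_j · (n − j) ≤ u_{j+1} · (j + 1)` of the Boolean lattice — the closures at level `j + 1` may be
non-trivial, pooling the targets only helps (`normConsStep_of_indep_succ_of_indep_sdiff`; this sharpens the girth regime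
`normConsStep_of_indep`, which asked for every `(n − j + 1)`-subset).  CONSEQUENCE: **(NC) holds for every uniform matroid**
(`normConsAt_of_uniform`): below the rank the steps are Boolean, at and above it they are the top steps.  For a paving matroid
of rank `r` on `n ≤ 2r − 3` elements every step except the bottom one `j = n − r` (where `BI_j` is the family of co-bases) is
Boolean by the same lemma (paper §8: there (NC) is the statement (SP) about codes).  Nothing here asserts (NC).
-/

open scoped Matroid

namespace PercRepro.Cogirth

open Finset ThmH Skew

variable {α : Type} [DecidableEq α] {M : Matroid α} [M.Finite]

omit [DecidableEq α] in
/-- If every `m`-subset of `E` is independent (`m ≤ n`), so is every subset with at most `m` elements. -/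
theorem rk_eq_card_of_card_le_of_indep {m : ℕ} (hm : m ≤ (gr M).card)
    (hg : ∀ S ⊆ gr M, S.card = m → rk M S = S.card) {S : Finset α} (hS : S ⊆ gr M) (hSm : S.card ≤ m) :
    rk M S = S.card := by
  obtain ⟨T, hST, hTg, hTc⟩ := exists_subsuperset_card_eq hS hSm hm
  exact rk_eq_card_of_subset_of_rk_eq_card hST (hg T hTg hTc)

/-- If every `j`-subset and every `(n − j)`-subset of `E` is independent, `BI_j` is the whole Boolean level. -/
theorem biIndepSets_eq_powersetCard_of_indep_of_indep {j : ℕ}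
    (hj : ∀ S ⊆ gr M, S.card = j → rk M S = S.card)
    (hj' : ∀ S ⊆ gr M, S.card = (gr M).card - j → rk M S = S.card) :
    biIndepSets M j = (gr M).powersetCard j := by
  ext X
  rw [mem_powersetCard, mem_biIndepSets]
  constructor
  · rintro ⟨hXg, hXj, -, -⟩
    exact ⟨hXg, hXj⟩
  · rintro ⟨hXg, hXj⟩
    refine ⟨hXg, hXj, hj X hXg hXj, hj' _ sdiff_subset ?_⟩
    rw [card_sdiff_of_subset hXg, hXj]

/-- If every `(j + 1)`-subset of `E` is independent, every `j`-subset is its own closure. -/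
theorem clF_eq_self_of_indep_succ' {j : ℕ} (hg : ∀ S ⊆ gr M, S.card = j + 1 → rk M S = S.card)
    {X : Finset α} (hX : X ⊆ gr M) (hXj : X.card = j) : clF M X = X := by
  apply Subset.antisymm
  · intro e he
    by_contra heX
    have heg : e ∈ gr M := clF_subset_gr_fu X he
    have h1 := rk_insert_eq heg hX
    rw [if_pos he] at h1
    have h2 := hg (insert e X) (insert_subset heg hX) (by rw [card_insert_of_notMem heX, hXj])
    rw [card_insert_of_notMem heX] at h2
    have h3 : rk M X ≤ X.card := rk_le_card X
    omega
  · exact subset_clF_fu hX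

/-- **THE BOOLEAN STEP**: if every `(j + 1)`-subset and every `(n − j)`-subset of `E` is independent (`j + 1 ≤ n`), the step
of (NC) at level `j` holds for every up-set `U` of flats — the local LYM inequality of the Boolean lattice. -/
theorem normConsStep_of_indep_succ_of_indep_sdiff {U : Finset (Finset α)} (hU : UpFlats M U) {j : ℕ}
    (hjn : j + 1 ≤ (gr M).card)
    (hs : ∀ S ⊆ gr M, S.card = j + 1 → rk M S = S.card)
    (hc : ∀ S ⊆ gr M, S.card = (gr M).card - j → rk M S = S.card) : NormConsStep M U j := by
  have hj : ∀ S ⊆ gr M, S.card = j → rk M S = S.card := fun S hS hSc =>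
    rk_eq_card_of_card_le_of_indep hjn hs hS (by omega)
  have hc' : ∀ S ⊆ gr M, S.card = (gr M).card - (j + 1) → rk M S = S.card := fun S hS hSc =>
    rk_eq_card_of_card_le_of_indep (Nat.sub_le _ _) hc hS (by omega)
  have hB0 := biIndepSets_eq_powersetCard_of_indep_of_indep (M := M) hj hc
  have hB1 := biIndepSets_eq_powersetCard_of_indep_of_indep (M := M) hs hc'
  unfold NormConsStep upCount
  rw [hB0, hB1, card_powersetCard, card_powersetCard]
  set 𝒜 := ((gr M).powersetCard j).filter (fun X => clF M X ∈ U) with h𝒜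
  set ℬ := ((gr M).powersetCard (j + 1)).filter (fun X => clF M X ∈ U) with hℬ
  have hlym : 𝒜.card * ((gr M).card - j) ≤ ℬ.card * (j + 1) := by
    apply card_mul_le_card_mul_of_insert_mem (E := gr M) (j := j)
    · intro X hX
      rw [h𝒜, mem_filter, mem_powersetCard] at hX
      exact hX.1
    · intro Y hY
      rw [hℬ, mem_filter, mem_powersetCard] at hY
      exact hY.1.2
    · intro X hX a ha haX
      rw [h𝒜, mem_filter, mem_powersetCard] at hX
      obtain ⟨⟨hXg, hXj⟩, hXU⟩ := hX
      have hins : insert a X ⊆ gr M := insert_subset ha hXg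
      have hcard : (insert a X).card = j + 1 := by rw [card_insert_of_notMem haX, hXj]
      rw [hℬ, mem_filter, mem_powersetCard]
      refine ⟨⟨hins, hcard⟩, ?_⟩
      have hcl : clF M X = X := clF_eq_self_of_indep_succ' hs hXg hXj
      rw [hcl] at hXU
      exact hU.up X hXU _ (isFlatF_clF _) ((subset_insert _ _).trans (subset_clF_fu hins))
  have hbin := Nat.choose_succ_right_eq (gr M).card j
  have hpos : 0 < j + 1 := Nat.succ_pos j
  have h1 : 𝒜.card * (gr M).card.choose (j + 1) * (j + 1) ≤ ℬ.card * (gr M).card.choose j * (j + 1) := by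
    calc 𝒜.card * (gr M).card.choose (j + 1) * (j + 1) = 𝒜.card * ((gr M).card.choose (j + 1) * (j + 1)) := by ring
      _ = 𝒜.card * ((gr M).card.choose j * ((gr M).card - j)) := by rw [hbin]
      _ = (𝒜.card * ((gr M).card - j)) * (gr M).card.choose j := by ring
      _ ≤ (ℬ.card * (j + 1)) * (gr M).card.choose j := Nat.mul_le_mul_right _ hlym
      _ = ℬ.card * (gr M).card.choose j * (j + 1) := by ring
  exact Nat.le_of_mul_le_mul_right h1 hpos

/-- A matroid is UNIFORM when every subset of at most `rk E` elements is independent. -/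
def IsUniformF (M : Matroid α) [M.Finite] : Prop :=
  ∀ S ⊆ gr M, S.card ≤ rk M (gr M) → rk M S = S.card

/-- **(NC) HOLDS FOR EVERY UNIFORM MATROID** (unconditional). -/
theorem normConsAt_of_uniform (hu : IsUniformF M) : NormConsAt M := by
  intro U hU j
  rcases Nat.lt_or_ge j (rk M (gr M) - 1) with hj | hj
  · -- j + 1 < rk: both levels are Boolean (or the bottom is empty)
    rcases Nat.lt_or_ge (j + rk M (gr M)) (gr M).card with hlo | hlo
    · exact normConsStep_of_lt U hlo
    · have hrk : rk M (gr M) ≤ (gr M).card := rk_le_card _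
      apply normConsStep_of_indep_succ_of_indep_sdiff hU (by omega)
      · intro S hS hSc
        exact hu S hS (by omega)
      · intro S hS hSc
        exact hu S hS (by omega)
  · exact normConsStep_of_rk_le hU (by omega)

end PercRepro.Cogirth
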